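import Literature.Probability.ODonnellSaksSchrammServedio2005.BiasedCube
import HarnessLib

/-!
# The two-function OSSS inequality on a biased product cube (O'Donnell–Saks–Schramm–Servedio 2005)

CITATION HEADER. Source: R. O'Donnell, M. Saks, O. Schramm, R. A. Servedio, *Every decision tree has an
influential variable*, Proc. 46th IEEE FOCS (2005), arXiv:cs/0508071, §3 (Thm 3.1 for general product
probability spaces; the two-function "alternate version" after Thm 3.2).  What is reproduced, fully proved:
for a finite index type `ι`, biases `p : ι → ℝ`, the product weight `wt p` of `BiasedCube.lean`, a reduced
deterministic adaptive decision tree `T` on `ι → Bool` with real leaf labels of absolute value `≤ 1`, and ANY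
`g : (ι → Bool) → ℝ`,

  `E_p[T.eval · g] − E_p[T.eval] E_p[g] ≤ ∑_j δ_j^p(T) · Inf_j^{ρ₁}[g]`          (`DecTree.osss_cov`),

where `δ_j^p(T) = P_p[T queries j]` (`DecTree.qprob`, with its semantics `DecTree.qprob_eq_sum_queried`) and
`Inf_j^{ρ₁}[g] = E|g(y) − g(y^{(j)})|` is the resampling influence `infl p j g`.  This is the companion of
the uniform-cube file `DecisionTreeCovariance.lean` (same hybrid argument; here every averaging step carries
the weights `p_i`, `1 − p_i`), written for the percolation application (Duminil-Copin–Raoufi–Tassion /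
Hutchcroft: `Cov[f,g] ≤ ∑_e δ_e Cov[f, ω_e]` for increasing Boolean `f`, which is `osss_cov` applied to
`2f − 1`, `2g − 1` together with `infl_eq`).  Everything is finite sums; no measure theory.

PROOF ROUTE (as in the uniform file). HYBRID BOUND `E_{x,y}|g(y) − g(T.hybrid x y)| ≤ ∑_j δ_j(T) Inf_j[g]`
(`DecTree.hybrid_bound`) and LEAF STEP `E_{x,y}[T.eval y · g(T.hybrid x y)] = E[T.eval] E[g]`
(`DecTree.sum_eval_mul_hybrid`), both by induction on the reduced tree through the weighted swap involution
`sum_sum_wt_swap` and the one-coordinate integration `sum_wt_ite`.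
-/

namespace Literature.Probability.ODonnellSaksSchrammServedio2005

open Finset Function

variable {ι : Type*}

/-- Deterministic adaptive decision trees on `ι → Bool` with real leaf labels: `node i t₀ t₁` queries
coordinate `i` and continues with `t₁` if it is `true`, with `t₀` otherwise ("a deterministic decision
tree (DDT) computing `f`"). [cite: OdonnellEtAl2005, §1 p. 3 (deterministic decision trees)] -/
inductive DecTree (ι : Type*) : Type _
  | leaf : ℝ → DecTree ι
  | node : ι → DecTree ι → DecTree ι → DecTree ι

namespace DecTree

/-- Output of the tree on input `x`. [folklore] -/
def eval : DecTree ι → (ι → Bool) → ℝ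
  | leaf v, _ => v
  | node i t₀ t₁, x => if x i then t₁.eval x else t₀.eval x

variable [DecidableEq ι]

/-- The variables occurring anywhere in the tree. [folklore] -/
def vars : DecTree ι → Finset ι
  | leaf _ => ∅
  | node i t₀ t₁ => insert i (t₀.vars ∪ t₁.vars)

/-- The variables queried along the computation path of the input `x` (non-Prop plumbing). [folklore] -/
def queried : DecTree ι → (ι → Bool) → Finset ι
  | leaf _, _ => ∅
  | node i t₀ t₁, x => insert i (if x i then t₁.queried x else t₀.queried x)

/-- Reduced trees: a queried variable does not occur again below the node querying it ("we may assume
that `T` never queries a variable more than once"). [cite: OdonnellEtAl2005, §3.2 proof of Thm 3.1 (no variable queried twice)] -/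
def Reduced : DecTree ι → Prop
  | leaf _ => True
  | node i t₀ t₁ => i ∉ t₀.vars ∧ i ∉ t₁.vars ∧ t₀.Reduced ∧ t₁.Reduced

/-- Query weights `δ_j^p(T)`: for a reduced tree, the probability under the biased product law that `T`
queries `j` (defined by the recursion it satisfies; semantics in `qprob_eq_sum_queried`).
[cite: OdonnellEtAl2005, §1 definition of δ_i p. 3] -/
noncomputable def qprob (p : ι → ℝ) : DecTree ι → ι → ℝ
  | leaf _, _ => 0
  | node i t₀ t₁, j => (if j = i then 1 else 0) + ((1 - p i) * t₀.qprob p j + p i * t₁.qprob p j)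

/-- The OSSS hybrid input: agrees with `x` on the variables `T` queries along the path of `y`, and with
`y` elsewhere. [cite: OdonnellEtAl2005, proof of Thm 3.1 p. 7] -/
def hybrid : DecTree ι → (ι → Bool) → (ι → Bool) → (ι → Bool)
  | leaf _, _, y => y
  | node i t₀ t₁, x, y =>
      if y i then t₁.hybrid x (update y i (x i)) else t₀.hybrid x (update y i (x i))

/-- Queried variables occur in the tree. [cite: OdonnellEtAl2005, §1 p. 3 (variables queried by T)] -/
theorem queried_subset_vars (T : DecTree ι) (x : ι → Bool) : T.queried x ⊆ T.vars := by
  induction T with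
  | leaf v => simp [queried, vars]
  | node i t₀ t₁ ih₀ ih₁ =>
    intro j hj
    simp only [queried, Finset.mem_insert] at hj
    simp only [vars, Finset.mem_insert, Finset.mem_union]
    rcases hj with h | h
    · exact Or.inl h
    · split_ifs at h
      · exact Or.inr (Or.inr (ih₁ h))
      · exact Or.inr (Or.inl (ih₀ h))

/-- Query weights `δ_j` are nonnegative (biases in `[0,1]`). [cite: OdonnellEtAl2005, §1 definition of δ_i p. 3] -/
theorem qprob_nonneg {p : ι → ℝ} (h0 : ∀ i, 0 ≤ p i) (h1 : ∀ i, p i ≤ 1) (T : DecTree ι) (j : ι) :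
    0 ≤ T.qprob p j := by
  induction T with
  | leaf v => simp [qprob]
  | node i t₀ t₁ ih₀ ih₁ =>
    simp only [qprob]
    have : 0 ≤ 1 - p i := by linarith [h1 i]
    have := h0 i
    split_ifs <;> positivity

/-- A subtree not containing `i` does not read coordinate `i`. [folklore] -/
private theorem eval_update_of_not_mem {T : DecTree ι} {i : ι} (h : i ∉ T.vars) (x : ι → Bool) (c : Bool) :
    T.eval (update x i c) = T.eval x := by
  induction T with
  | leaf v => simp [eval]
  | node j t₀ t₁ ih₀ ih₁ =>
    simp only [vars, Finset.mem_insert, Finset.mem_union, not_or] at h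
    obtain ⟨hij, h₀, h₁⟩ := h
    have hj : update x i c j = x j := update_of_ne (fun e => hij e.symm) _ _
    simp only [eval, hj, ih₀ h₀, ih₁ h₁]

/-- The queried set of a subtree not containing `i` does not read coordinate `i`. [folklore] -/
private theorem queried_update_of_not_mem {T : DecTree ι} {i : ι} (h : i ∉ T.vars) (x : ι → Bool) (c : Bool) :
    T.queried (update x i c) = T.queried x := by
  induction T with
  | leaf v => simp [queried]
  | node j t₀ t₁ ih₀ ih₁ =>
    simp only [vars, Finset.mem_insert, Finset.mem_union, not_or] at h
    obtain ⟨hij, h₀, h₁⟩ := h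
    have hj : update x i c j = x j := update_of_ne (fun e => hij e.symm) _ _
    simp only [queried, hj, ih₀ h₀, ih₁ h₁]

/-- The hybrid of a subtree not containing `i` does not read coordinate `i` of `x`. [folklore] -/
private theorem hybrid_update_left {T : DecTree ι} {i : ι} (h : i ∉ T.vars) (x y : ι → Bool) (c : Bool) :
    T.hybrid (update x i c) y = T.hybrid x y := by
  induction T generalizing y with
  | leaf v => simp [hybrid]
  | node j t₀ t₁ ih₀ ih₁ =>
    simp only [vars, Finset.mem_insert, Finset.mem_union, not_or] at h
    obtain ⟨hij, h₀, h₁⟩ := h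
    have hj : update x i c j = x j := update_of_ne (fun e => hij e.symm) _ _
    simp only [hybrid, hj, ih₀ h₀, ih₁ h₁]

variable [Fintype ι]

/-- SEMANTICS OF THE QUERY WEIGHTS: for a reduced tree, `δ_j^p(T) = P_p(j is queried along the input)`.
[cite: OdonnellEtAl2005, §1 p. 3 ("δ_i = Pr[T queries x_i]")] -/
theorem qprob_eq_sum_queried (p : ι → ℝ) (T : DecTree ι) (hT : T.Reduced) (j : ι) :
    T.qprob p j = ∑ x, wt p x * (if j ∈ T.queried x then 1 else 0) := by
  induction T with
  | leaf v => simp [qprob, queried]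
  | node i t₀ t₁ ih₀ ih₁ =>
    simp only [Reduced] at hT
    obtain ⟨hi₀, hi₁, hr₀, hr₁⟩ := hT
    -- split the indicator: `[j ∈ insert i S_x] = [j = i] + [j ≠ i][j ∈ S_x]`, and `i ∉ S_x`
    have hsplit : ∀ x : ι → Bool, (if j ∈ (node i t₀ t₁).queried x then (1 : ℝ) else 0)
        = (if j = i then (1 : ℝ) else 0)
          + (if x i = true then (if j ∈ t₁.queried x then (1 : ℝ) else 0)
              else (if j ∈ t₀.queried x then (1 : ℝ) else 0)) := by
      intro x
      by_cases hji : j = i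
      · subst hji
        have h1 : j ∉ t₁.queried x := fun h => hi₁ (queried_subset_vars _ _ h)
        have h0 : j ∉ t₀.queried x := fun h => hi₀ (queried_subset_vars _ _ h)
        simp [queried, h1, h0]
      · simp only [queried, Finset.mem_insert, hji, false_or, if_false, zero_add]
        split_ifs <;> simp_all
    simp_rw [hsplit, mul_add, Finset.sum_add_distrib]
    rw [sum_wt_ite p i _ _ (fun x c => by rw [queried_update_of_not_mem hi₁])
      (fun x c => by rw [queried_update_of_not_mem hi₀]), ← Finset.sum_mul, sum_wt, one_mul,
      ← ih₀ hr₀, ← ih₁ hr₁, qprob]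
    ring

/-- THE HYBRID BOUND: `E_{x,y}|g(y) − g(T.hybrid x y)| ≤ ∑_j δ_j^p(T) · Inf_j^{ρ₁}[g]` — the chain of
inequalities (8)–(10) of the OSSS proof, in inductive form, on the biased cube.
[cite: OdonnellEtAl2005, proof of Thm 3.1 pp. 7–8] -/
theorem hybrid_bound (p : ι → ℝ) (h0 : ∀ i, 0 ≤ p i) (h1 : ∀ i, p i ≤ 1) (T : DecTree ι)
    (hT : T.Reduced) (g : (ι → Bool) → ℝ) :
    ∑ x, ∑ y, wt p x * wt p y * |g y - g (T.hybrid x y)| ≤ ∑ j, T.qprob p j * infl p j g := by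
  induction T with
  | leaf v => simp [hybrid, qprob]
  | node i t₀ t₁ ih₀ ih₁ =>
    simp only [Reduced] at hT
    obtain ⟨hi₀, hi₁, hr₀, hr₁⟩ := hT
    have IH₀ := ih₀ hr₀
    have IH₁ := ih₁ hr₁
    -- pointwise triangle inequality through the first hybrid `y^{i→x_i}`
    have step : ∀ x y, wt p x * wt p y * |g y - g ((node i t₀ t₁).hybrid x y)| ≤
        wt p x * wt p y * |g y - g (update y i (x i))| +
        wt p x * wt p y * (if y i = true then |g (update y i (x i)) - g (t₁.hybrid x (update y i (x i)))|
          else |g (update y i (x i)) - g (t₀.hybrid x (update y i (x i)))|) := by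
      intro x y
      rw [← mul_add]
      refine mul_le_mul_of_nonneg_left ?_ (mul_nonneg (wt_nonneg h0 h1 x) (wt_nonneg h0 h1 y))
      simp only [hybrid]
      split_ifs with h
      · exact abs_sub_le _ _ _
      · exact abs_sub_le _ _ _
    -- the swap involution turns the branch on `y i` into a branch on the independent bit `x i`
    have swap : ∑ x, ∑ y, wt p x * wt p y *
          (if x i = true then |g y - g (t₁.hybrid x y)| else |g y - g (t₀.hybrid x y)|)
        = ∑ x, ∑ y, wt p x * wt p y *
          (if y i = true then |g (update y i (x i)) - g (t₁.hybrid x (update y i (x i)))|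
            else |g (update y i (x i)) - g (t₀.hybrid x (update y i (x i)))|) := by
      refine (sum_sum_wt_swap p i (fun x y =>
        if x i = true then |g y - g (t₁.hybrid x y)| else |g y - g (t₀.hybrid x y)|)).trans ?_
      refine Finset.sum_congr rfl fun x _ => Finset.sum_congr rfl fun y _ => ?_
      simp only [update_self, hybrid_update_left hi₁, hybrid_update_left hi₀]
    -- independence of `x i`: the branch averages the two subtrees with weights `p i`, `1 - p i`
    have half : ∑ x, ∑ y, wt p x * wt p y *
          (if x i = true then |g y - g (t₁.hybrid x y)| else |g y - g (t₀.hybrid x y)|)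
        = p i * (∑ x, ∑ y, wt p x * wt p y * |g y - g (t₁.hybrid x y)|)
          + (1 - p i) * ∑ x, ∑ y, wt p x * wt p y * |g y - g (t₀.hybrid x y)| := by
      have hpull : ∀ x : ι → Bool, (∑ y, wt p x * wt p y *
            (if x i = true then |g y - g (t₁.hybrid x y)| else |g y - g (t₀.hybrid x y)|))
          = wt p x * (if x i = true then ∑ y, wt p y * |g y - g (t₁.hybrid x y)|
              else ∑ y, wt p y * |g y - g (t₀.hybrid x y)|) := by
        intro x
        split_ifs <;> (rw [Finset.mul_sum]; exact Finset.sum_congr rfl fun y _ => by ring)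
      have hin : ∀ (t : DecTree ι) (x : ι → Bool), ∑ y, wt p x * wt p y * |g y - g (t.hybrid x y)|
          = wt p x * ∑ y, wt p y * |g y - g (t.hybrid x y)| := by
        intro t x
        rw [Finset.mul_sum]; exact Finset.sum_congr rfl fun y _ => by ring
      rw [Finset.sum_congr rfl (fun x _ => hpull x)]
      rw [sum_wt_ite p i _ _ (fun x c => by simp only [hybrid_update_left hi₁])
        (fun x c => by simp only [hybrid_update_left hi₀])]
      rw [Finset.sum_congr rfl (fun x _ => hin t₁ x), Finset.sum_congr rfl (fun x _ => hin t₀ x)]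
    -- bookkeeping of the weights
    have alg : ∑ j, (node i t₀ t₁).qprob p j * infl p j g
        = infl p i g + (p i * (∑ j, t₁.qprob p j * infl p j g)
          + (1 - p i) * ∑ j, t₀.qprob p j * infl p j g) := by
      have h1 : ∑ j, (node i t₀ t₁).qprob p j * infl p j g
          = ∑ j, ((if j = i then infl p j g else 0)
            + (p i * (t₁.qprob p j * infl p j g) + (1 - p i) * (t₀.qprob p j * infl p j g))) := by
        refine Finset.sum_congr rfl fun j _ => ?_
        simp only [qprob]
        split_ifs <;> ring
      rw [h1, Finset.sum_add_distrib, Finset.sum_ite_eq' Finset.univ i, if_pos (Finset.mem_univ _),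
        Finset.sum_add_distrib, ← Finset.mul_sum, ← Finset.mul_sum]
    have hfirst : ∑ x, ∑ y, wt p x * wt p y * |g y - g (update y i (x i))| = infl p i g := rfl
    calc ∑ x, ∑ y, wt p x * wt p y * |g y - g ((node i t₀ t₁).hybrid x y)|
        ≤ ∑ x, ∑ y, (wt p x * wt p y * |g y - g (update y i (x i))| +
            wt p x * wt p y *
              (if y i = true then |g (update y i (x i)) - g (t₁.hybrid x (update y i (x i)))|
                else |g (update y i (x i)) - g (t₀.hybrid x (update y i (x i)))|)) :=
          Finset.sum_le_sum fun x _ => Finset.sum_le_sum fun y _ => step x y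
      _ = infl p i g + (p i * (∑ x, ∑ y, wt p x * wt p y * |g y - g (t₁.hybrid x y)|)
          + (1 - p i) * ∑ x, ∑ y, wt p x * wt p y * |g y - g (t₀.hybrid x y)|) := by
          simp only [Finset.sum_add_distrib]
          rw [hfirst, ← swap, half]
      _ ≤ infl p i g + (p i * (∑ j, t₁.qprob p j * infl p j g)
          + (1 - p i) * ∑ j, t₀.qprob p j * infl p j g) := by
          have hp0 := h0 i
          have hp1 : 0 ≤ 1 - p i := by linarith [h1 i]
          nlinarith [IH₀, IH₁]
      _ = ∑ j, (node i t₀ t₁).qprob p j * infl p j g := by rw [alg]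

/-- THE LEAF STEP: `E_{x,y}[T.eval y · g(T.hybrid x y)] = E[T.eval] · E[g]` — the full hybrid has the
product law and is independent of the leaf reached by `y`. [cite: OdonnellEtAl2005, §3.3 p. 8] -/
theorem sum_eval_mul_hybrid (p : ι → ℝ) (T : DecTree ι) (hT : T.Reduced) (g : (ι → Bool) → ℝ) :
    ∑ x, ∑ y, wt p x * wt p y * (T.eval y * g (T.hybrid x y))
      = (∑ y, wt p y * T.eval y) * ∑ z, wt p z * g z := by
  induction T with
  | leaf v =>
    simp only [eval, hybrid]
    have h1 : ∑ x, ∑ y, wt p x * wt p y * (v * g y) = (∑ x : ι → Bool, wt p x) * ∑ y, wt p y * (v * g y) := by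
      rw [Finset.sum_mul]
      exact Finset.sum_congr rfl fun x _ => by rw [Finset.mul_sum]; exact Finset.sum_congr rfl fun y _ => by ring
    rw [h1, sum_wt, one_mul]
    have h2 : ∑ y, wt p y * v = v := by rw [← Finset.sum_mul, sum_wt, one_mul]
    rw [h2, Finset.mul_sum]
    exact Finset.sum_congr rfl fun y _ => by ring
  | node i t₀ t₁ ih₀ ih₁ =>
    simp only [Reduced] at hT
    obtain ⟨hi₀, hi₁, hr₀, hr₁⟩ := hT
    have IH₀ := ih₀ hr₀
    have IH₁ := ih₁ hr₁
    have hsum : ∀ x y, wt p x * wt p y * ((node i t₀ t₁).eval y * g ((node i t₀ t₁).hybrid x y))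
        = wt p x * wt p y * (if y i = true then t₁.eval (update y i (x i)) * g (t₁.hybrid x (update y i (x i)))
          else t₀.eval (update y i (x i)) * g (t₀.hybrid x (update y i (x i)))) := by
      intro x y
      simp only [eval, hybrid, eval_update_of_not_mem hi₁, eval_update_of_not_mem hi₀]
      split_ifs <;> rfl
    have swap : ∑ x, ∑ y, wt p x * wt p y *
          (if x i = true then t₁.eval y * g (t₁.hybrid x y) else t₀.eval y * g (t₀.hybrid x y))
        = ∑ x, ∑ y, wt p x * wt p y *
          (if y i = true then t₁.eval (update y i (x i)) * g (t₁.hybrid x (update y i (x i)))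
            else t₀.eval (update y i (x i)) * g (t₀.hybrid x (update y i (x i)))) := by
      refine (sum_sum_wt_swap p i (fun x y =>
        if x i = true then t₁.eval y * g (t₁.hybrid x y) else t₀.eval y * g (t₀.hybrid x y))).trans ?_
      refine Finset.sum_congr rfl fun x _ => Finset.sum_congr rfl fun y _ => ?_
      simp only [update_self, hybrid_update_left hi₁, hybrid_update_left hi₀]
    have hin : ∀ (t : DecTree ι) (x : ι → Bool), ∑ y, wt p x * wt p y * (t.eval y * g (t.hybrid x y))
        = wt p x * ∑ y, wt p y * (t.eval y * g (t.hybrid x y)) := by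
      intro t x
      rw [Finset.mul_sum]; exact Finset.sum_congr rfl fun y _ => by ring
    have half : ∑ x, ∑ y, wt p x * wt p y *
          (if x i = true then t₁.eval y * g (t₁.hybrid x y) else t₀.eval y * g (t₀.hybrid x y))
        = p i * (∑ x, ∑ y, wt p x * wt p y * (t₁.eval y * g (t₁.hybrid x y)))
          + (1 - p i) * ∑ x, ∑ y, wt p x * wt p y * (t₀.eval y * g (t₀.hybrid x y)) := by
      have hpull : ∀ x : ι → Bool, (∑ y, wt p x * wt p y *
            (if x i = true then t₁.eval y * g (t₁.hybrid x y) else t₀.eval y * g (t₀.hybrid x y)))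
          = wt p x * (if x i = true then ∑ y, wt p y * (t₁.eval y * g (t₁.hybrid x y))
              else ∑ y, wt p y * (t₀.eval y * g (t₀.hybrid x y))) := by
        intro x
        split_ifs <;> (rw [Finset.mul_sum]; exact Finset.sum_congr rfl fun y _ => by ring)
      rw [Finset.sum_congr rfl (fun x _ => hpull x)]
      rw [sum_wt_ite p i _ _ (fun x c => by simp only [hybrid_update_left hi₁])
        (fun x c => by simp only [hybrid_update_left hi₀])]
      rw [Finset.sum_congr rfl (fun x _ => hin t₁ x), Finset.sum_congr rfl (fun x _ => hin t₀ x)]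
    have hf : ∑ y, wt p y * (node i t₀ t₁).eval y
        = p i * ∑ y, wt p y * t₁.eval y + (1 - p i) * ∑ y, wt p y * t₀.eval y := by
      simp only [eval]
      exact sum_wt_ite p i _ _ (fun y c => eval_update_of_not_mem hi₁ y c)
        (fun y c => eval_update_of_not_mem hi₀ y c)
    calc ∑ x, ∑ y, wt p x * wt p y * ((node i t₀ t₁).eval y * g ((node i t₀ t₁).hybrid x y))
        = ∑ x, ∑ y, wt p x * wt p y *
          (if y i = true then t₁.eval (update y i (x i)) * g (t₁.hybrid x (update y i (x i)))
            else t₀.eval (update y i (x i)) * g (t₀.hybrid x (update y i (x i)))) :=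
          Finset.sum_congr rfl fun x _ => Finset.sum_congr rfl fun y _ => hsum x y
      _ = p i * ((∑ y, wt p y * t₁.eval y) * ∑ z, wt p z * g z)
          + (1 - p i) * ((∑ y, wt p y * t₀.eval y) * ∑ z, wt p z * g z) := by
          rw [← swap, half, IH₁, IH₀]
      _ = (∑ y, wt p y * (node i t₀ t₁).eval y) * ∑ z, wt p z * g z := by rw [hf]; ring

/-- THE TWO-FUNCTION OSSS INEQUALITY ON A BIASED PRODUCT CUBE:
`E_p[f g] − E_p[f] E_p[g] ≤ ∑_j δ_j^p(T) · Inf_j^{ρ₁}[g]` for `f = T.eval` with `|f| ≤ 1`, `T` reduced, `g` any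
real function — OSSS's "alternate version" of Theorem 3.2 on a general (finite, Boolean-coordinate) product
probability space. [cite: OdonnellEtAl2005, §3.3 Thm 3.2 (alternate version) and §3.1 Thm 3.1] -/
theorem osss_cov (p : ι → ℝ) (h0 : ∀ i, 0 ≤ p i) (h1 : ∀ i, p i ≤ 1) (T : DecTree ι) (hT : T.Reduced)
    (hb : ∀ y, |T.eval y| ≤ 1) (g : (ι → Bool) → ℝ) :
    (∑ y, wt p y * (T.eval y * g y)) - (∑ y, wt p y * T.eval y) * (∑ y, wt p y * g y)
      ≤ ∑ j, T.qprob p j * infl p j g := by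
  rw [← sum_eval_mul_hybrid p T hT g,
    ← sum_sum_wt_mul_left p (fun y => T.eval y * g y)]
  -- `∑_x ∑_y w x w y (F x)` with `F x = eval x * g x`: rename the bound variables to match
  have hre : ∑ x, ∑ y, wt p x * wt p y * (T.eval x * g x)
      = ∑ x, ∑ y, wt p x * wt p y * (T.eval y * g y) := by
    rw [Finset.sum_comm]
    exact Finset.sum_congr rfl fun x _ => Finset.sum_congr rfl fun y _ => by ring
  rw [hre, ← Finset.sum_sub_distrib]
  calc ∑ x, ((∑ y, wt p x * wt p y * (T.eval y * g y))
        - ∑ y, wt p x * wt p y * (T.eval y * g (T.hybrid x y)))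
      = ∑ x, ∑ y, wt p x * wt p y * (T.eval y * (g y - g (T.hybrid x y))) := by
        refine Finset.sum_congr rfl fun x _ => ?_
        rw [← Finset.sum_sub_distrib]
        exact Finset.sum_congr rfl fun y _ => by ring
    _ ≤ ∑ x, ∑ y, wt p x * wt p y * |g y - g (T.hybrid x y)| := by
        refine Finset.sum_le_sum fun x _ => Finset.sum_le_sum fun y _ => ?_
        refine mul_le_mul_of_nonneg_left ?_ (mul_nonneg (wt_nonneg h0 h1 x) (wt_nonneg h0 h1 y))
        calc T.eval y * (g y - g (T.hybrid x y)) ≤ |T.eval y * (g y - g (T.hybrid x y))| := le_abs_self _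
          _ = |T.eval y| * |g y - g (T.hybrid x y)| := abs_mul _ _
          _ ≤ 1 * |g y - g (T.hybrid x y)| := mul_le_mul_of_nonneg_right (hb y) (abs_nonneg _)
          _ = |g y - g (T.hybrid x y)| := one_mul _
    _ ≤ _ := hybrid_bound p h0 h1 T hT g

end DecTree

end Literature.Probability.ODonnellSaksSchrammServedio2005
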